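import Literature.MathematicalPhysics.QuantumFieldTheory.TwistedPartitionFunction
import Literature.MathematicalPhysics.QuantumFieldTheory.TomboulisVortexDecimation
import HarnessLib

/-!
# The twisted partition functions do not depend on the twisted plane (relabelling of the axes)

Tomboulis (arXiv:0707.2179, §4, text before eq. (4.3)) puts the twist on a coclosed plaquette set
`𝒱_{μν}` winding around the torus in the directions perpendicular to the `(μ, ν)`-plane and then fixes
"for definiteness, … say, `μ = 1, ν = 2`". On the symmetric torus `(ℤ/Lℤ)^d` of
`TomboulisVortexDecimation` that choice is immaterial: a transposition of two axes is a relabelling of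
the link variables (`TwistedPartitionFunction.configTranspose`) preserving the product Haar measure
(`measurePreserving_configTransposeEquiv`); it permutes the plaquettes (`plaqTranspose`, an involution),
up to the orientation of the plaquettes whose two directions get re-sorted
(`plaquetteHolonomy_configTranspose`), and the plaquette functions `f`, `f⁻` — polynomials in the real
characters `χ_j` — are invariant under `U ↦ U⁻¹`. Hence (every spin cut-off `J`, all coefficients,
every `d`, `L`):

* `torusZtw_image_plaqTranspose`: `Z⁻_Λ(τV) = Z⁻_Λ(V)` for every twist set `V` and every transposition
  `τ` of the axes; `vortexRatio_image_plaqTranspose`.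
* `torusZtw_vortexSheet_eq_zero_plane`: `Z⁻_Λ(𝒱_{ij}) = Z⁻_Λ(𝒱_{0j})` (`0 < i < j`);
  `torusZtw_vortexSheet_eq_plane_zero_one`: `Z⁻_Λ(𝒱_{ij}) = Z⁻_Λ(𝒱_{01})` for every plane; the same for
  `vortexRatio` and, as equivalences, for the Prop. IV.1 statement `TwistLe d L J 𝒱`
  (`twistLe_vortexSheet_iff_zero_plane`, `twistLe_vortexSheet_iff_plane_zero_one`).

Use: results proved with the reflection machinery of `ConstructiveQFTWave0Proofs`, whose time axis is
the `0`-th coordinate (e.g. `TwistLe d L 1 (vortexSheet L 0 j _)` on even tori), transfer to all planes.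

## References

* E. T. Tomboulis, arXiv:0707.2179, §4 [cite: Tomboulis2007Confinement, §4 (text before eq. (4.3))].
-/

noncomputable section

open MeasureTheory Finset
open scoped BigOperators
open Literature.MathematicalPhysics.QuantumLattice

namespace Literature.MathematicalPhysics.QuantumFieldTheory

namespace Tomboulis2007

variable {d L : ℕ}

/-! ### Transposition of plaquettes -/

/-- Transposition `μ ↔ ν` of an ordered pair of distinct directions, re-sorted. [folklore] -/
def dirTranspose (μ ν : Fin d) (q : {p : Fin d × Fin d // p.1 < p.2}) : {p : Fin d × Fin d // p.1 < p.2} :=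
  if h : Equiv.swap μ ν q.1.1 < Equiv.swap μ ν q.1.2 then ⟨(Equiv.swap μ ν q.1.1, Equiv.swap μ ν q.1.2), h⟩
  else ⟨(Equiv.swap μ ν q.1.2, Equiv.swap μ ν q.1.1),
    lt_of_le_of_ne (not_lt.1 h) fun e => q.2.ne ((Equiv.swap μ ν).injective e).symm⟩

/-- `dirTranspose` is an involution (plumbing). [folklore] -/
private theorem dirTranspose_dirTranspose (μ ν : Fin d) (q : {p : Fin d × Fin d // p.1 < p.2}) :
    dirTranspose μ ν (dirTranspose μ ν q) = q := by
  obtain ⟨⟨a, b⟩, hab⟩ := q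
  have hab' : a < b := hab
  by_cases h1 : Equiv.swap μ ν a < Equiv.swap μ ν b
  · have e1 : dirTranspose μ ν ⟨(a, b), hab⟩ = ⟨(Equiv.swap μ ν a, Equiv.swap μ ν b), h1⟩ := by
      unfold dirTranspose; rw [dif_pos h1]
    rw [e1]
    unfold dirTranspose
    simp only [Equiv.swap_apply_self]
    rw [dif_pos hab']
  · have e1 : dirTranspose μ ν ⟨(a, b), hab⟩ = ⟨(Equiv.swap μ ν b, Equiv.swap μ ν a),
        lt_of_le_of_ne (not_lt.1 h1) fun e => hab'.ne ((Equiv.swap μ ν).injective e).symm⟩ := by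
      unfold dirTranspose; rw [dif_neg h1]
    rw [e1]
    unfold dirTranspose
    simp only [Equiv.swap_apply_self]
    rw [dif_neg (lt_asymm hab')]

/-- Transposition `μ ↔ ν` of the axes acting on plaquettes: transpose the base point, exchange and
re-sort the two directions. [folklore] -/
def plaqTranspose (μ ν : Fin d) (p : Plaquette d L) : Plaquette d L :=
  (siteTranspose μ ν p.1, dirTranspose μ ν p.2)

/-- `plaqTranspose` is an involution (plumbing). [folklore] -/
private theorem plaqTranspose_plaqTranspose (μ ν : Fin d) (p : Plaquette d L) :
    plaqTranspose μ ν (plaqTranspose μ ν p) = p := by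
  obtain ⟨x, q⟩ := p
  simp only [plaqTranspose, siteTranspose_siteTranspose, dirTranspose_dirTranspose]

/-- `plaqTranspose` as a permutation of the plaquettes. [folklore] -/
def plaqTransposeEquiv (μ ν : Fin d) : Equiv.Perm (Plaquette d L) :=
  Function.Involutive.toPerm (plaqTranspose μ ν) (plaqTranspose_plaqTranspose μ ν)

/-- Membership in the transposed plaquette set (plumbing). [folklore] -/
private theorem mem_image_plaqTranspose (μ ν : Fin d) (V : Finset (Plaquette d L)) (p : Plaquette d L) :
    p ∈ V.image (plaqTranspose μ ν) ↔ plaqTranspose μ ν p ∈ V := by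
  constructor
  · intro h
    obtain ⟨q, hq, hqp⟩ := Finset.mem_image.1 h
    rw [← hqp, plaqTranspose_plaqTranspose]
    exact hq
  · intro h
    exact Finset.mem_image.2 ⟨_, h, plaqTranspose_plaqTranspose μ ν p⟩

/-- Reversing the orientation of a plaquette inverts its holonomy (plumbing). [folklore] -/
private theorem plaquetteHolonomy_rev {G : Type*} [Group G] (U : GaugeConfig d L G) (x : Site d L)
    (i j : Fin d) : plaquetteHolonomy U x j i = (plaquetteHolonomy U x i j)⁻¹ := by
  simp only [plaquetteHolonomy, mul_inv_rev, inv_inv, mul_assoc]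

/-- **Plaquette functions under transposition of the axes**: for an inversion-invariant `f`,
`f(U^{τ}_p) = f(U_{τ p})` (plumbing, from `plaquetteHolonomy_configTranspose`). [folklore] -/
private theorem apply_plaquetteHolonomy_configTranspose {G : Type*} [Group G] {α : Type*} (f : G → α)
    (hf : ∀ W, f W⁻¹ = f W) (μ ν : Fin d) (U : GaugeConfig d L G) (p : Plaquette d L) :
    f (plaquetteHolonomy (configTranspose μ ν U) p.1 p.2.1.1 p.2.1.2) =
      f (plaquetteHolonomy U (plaqTranspose μ ν p).1 (plaqTranspose μ ν p).2.1.1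
        (plaqTranspose μ ν p).2.1.2) := by
  rw [plaquetteHolonomy_configTranspose]
  obtain ⟨x, ⟨⟨a, b⟩, hab⟩⟩ := p
  simp only [plaqTranspose, dirTranspose]
  split_ifs with h
  · rfl
  · rw [plaquetteHolonomy_rev U (siteTranspose μ ν x) (Equiv.swap μ ν a) (Equiv.swap μ ν b), hf]

/-! ### `SU(2)` characters are inversion invariant -/

/-- `χ_j(W⁻¹) = χ_j(W)` on `SU(2)` (all characters of `SU(2)` are real; here from
`Re tr W⁻¹ = Re tr W`). [folklore] -/
private theorem su2Char_inv (n : ℕ) (W : SU2) : su2Char n W⁻¹ = su2Char n W := by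
  have h := Literature.RepresentationTheory.CompactGroups.CompactGroup.re_trace_map_inv
    (fundamentalRep (Fin 2)) (continuous_fundamentalRep (Fin 2)) W
  simp only [fundamentalRep_apply] at h
  unfold su2Char
  rw [h]

/-- `f(W⁻¹) = f(W)` (plumbing). [folklore] -/
private theorem plaqFn_inv (J : ℕ) (c : ℕ → ℝ) (W : SU2) : plaqFn J c W⁻¹ = plaqFn J c W := by
  simp only [plaqFn, su2Char_inv]

/-- `f⁻(W⁻¹) = f⁻(W)` (plumbing). [folklore] -/
private theorem plaqFnTwist_inv (J : ℕ) (c : ℕ → ℝ) (W : SU2) :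
    plaqFnTwist J c W⁻¹ = plaqFnTwist J c W := by
  simp only [plaqFnTwist, su2Char_inv]

/-! ### Invariance of `Z⁻` under relabelling of the axes -/

variable [NeZero L]

/-- **The twisted partition function is invariant under a transposition of the axes**:
`Z⁻_Λ(τV) = Z⁻_Λ(V)` for every twist set `V`, every spin cut-off and all coefficients (change of
variables `U ↦ U ∘ τ`, which preserves the product Haar measure; the plaquette functions are class
functions invariant under inversion). Tomboulis fixes the twisted plane "for definiteness, … say,
`μ = 1, ν = 2`" (arXiv:0707.2179 §4, text before eq. (4.3)); on the symmetric torus `(ℤ/Lℤ)^d` this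
lemma is what makes that choice immaterial. [cite: Tomboulis2007Confinement, §4 (text before eq. (4.3))] -/
theorem torusZtw_image_plaqTranspose (μ ν : Fin d) (J : ℕ) (c : ℕ → ℝ) (V : Finset (Plaquette d L)) :
    torusZtw d L J c (V.image (plaqTranspose μ ν)) = torusZtw d L J c V := by
  unfold torusZtw
  rw [← (measurePreserving_configTransposeEquiv (G := SU2) μ ν).integral_comp'
    (fun U : GaugeConfig d L SU2 => ∏ p : Plaquette d L,
      (if p ∈ V then plaqFnTwist J c (plaquetteHolonomy U p.1 p.2.1.1 p.2.1.2)
        else plaqFn J c (plaquetteHolonomy U p.1 p.2.1.1 p.2.1.2)))]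
  refine integral_congr_ae (ae_of_all _ fun U => ?_)
  simp only [configTransposeEquiv_apply]
  have hfac : ∀ p : Plaquette d L,
      (if p ∈ V then plaqFnTwist J c (plaquetteHolonomy (configTranspose μ ν U) p.1 p.2.1.1 p.2.1.2)
        else plaqFn J c (plaquetteHolonomy (configTranspose μ ν U) p.1 p.2.1.1 p.2.1.2)) =
      (fun q : Plaquette d L => if q ∈ V.image (plaqTranspose μ ν)
          then plaqFnTwist J c (plaquetteHolonomy U q.1 q.2.1.1 q.2.1.2)
          else plaqFn J c (plaquetteHolonomy U q.1 q.2.1.1 q.2.1.2)) (plaqTranspose μ ν p) := by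
    intro p
    simp only [mem_image_plaqTranspose, plaqTranspose_plaqTranspose]
    rw [apply_plaquetteHolonomy_configTranspose (plaqFnTwist J c) (plaqFnTwist_inv J c) μ ν U p,
      apply_plaquetteHolonomy_configTranspose (plaqFn J c) (plaqFn_inv J c) μ ν U p]
  symm
  rw [Finset.prod_congr rfl fun p _ => hfac p]
  exact Fintype.prod_equiv (plaqTransposeEquiv μ ν) _ _ fun p => rfl

/-- `Z⁻/Z` is invariant under a transposition of the axes. [cite: Tomboulis2007Confinement, §4 (text before eq. (4.3))] -/
theorem vortexRatio_image_plaqTranspose (μ ν : Fin d) (J : ℕ) (c : ℕ → ℝ)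
    (V : Finset (Plaquette d L)) :
    vortexRatio d L J c (V.image (plaqTranspose μ ν)) = vortexRatio d L J c V := by
  unfold vortexRatio
  rw [torusZtw_image_plaqTranspose]

/-! ### All vortex sheets are equivalent to one in a plane containing the `0`-axis -/

omit [NeZero L] in
/-- Coordinates other than the two transposed ones are unchanged (plumbing). [folklore] -/
private theorem siteTranspose_apply_of_ne' {μ ν k : Fin d} (hkμ : k ≠ μ) (hkν : k ≠ ν)
    (x : Site d L) : siteTranspose μ ν x k = x k := by
  simp [siteTranspose, Equiv.swap_apply_of_ne_of_ne hkμ hkν]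

omit [NeZero L] in
/-- The transposition `0 ↔ i` carries the direction pair `(0, j)` to `(i, j)` (`0 < i < j`)
(plumbing). [folklore] -/
private theorem dirTranspose_zero [NeZero d] {i j : Fin d} (hi : (0 : Fin d) < i) (hij : i < j) :
    dirTranspose 0 i ⟨((0 : Fin d), j), hi.trans hij⟩ = ⟨(i, j), hij⟩ := by
  have hj0 : j ≠ 0 := (hi.trans hij).ne'
  have hji : j ≠ i := hij.ne'
  have h1 : Equiv.swap (0 : Fin d) i 0 = i := Equiv.swap_apply_left _ _
  have h2 : Equiv.swap (0 : Fin d) i j = j := Equiv.swap_apply_of_ne_of_ne hj0 hji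
  unfold dirTranspose
  simp only [h1, h2]
  rw [dif_pos hij]

/-- **The vortex sheet in the plane `(i, j)` is the transposed image of the one in the plane
`(0, j)`** (`0 < i < j`, transposition `0 ↔ i` of the axes) (plumbing). [folklore] -/
private theorem image_plaqTranspose_vortexSheet [NeZero d] {i j : Fin d} (hi : (0 : Fin d) < i)
    (hij : i < j) :
    (vortexSheet L 0 j (hi.trans hij)).image (plaqTranspose 0 i) = vortexSheet L i j hij := by
  have hj0 : j ≠ 0 := (hi.trans hij).ne'
  have hji : j ≠ i := hij.ne'
  ext p
  rw [mem_image_plaqTranspose]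
  obtain ⟨x, q⟩ := p
  unfold vortexSheet
  simp only [Finset.mem_filter, Finset.mem_univ, true_and, plaqTranspose, siteTranspose_apply_left,
    siteTranspose_apply_of_ne' hj0 hji]
  have hq : dirTranspose 0 i q = ⟨((0 : Fin d), j), hi.trans hij⟩ ↔ q = ⟨(i, j), hij⟩ := by
    constructor
    · intro h
      rw [← dirTranspose_dirTranspose 0 i q, h, dirTranspose_zero hi hij]
    · intro h
      rw [h, ← dirTranspose_zero hi hij, dirTranspose_dirTranspose]
  rw [hq]

/-- **Every vortex sheet is worth one in a plane containing the `0`-axis**: for `0 < i < j`,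
`Z⁻_Λ(𝒱_{ij}) = Z⁻_Λ(𝒱_{0j})` (every `J`, all coefficients, every torus `(ℤ/Lℤ)^d`).
[cite: Tomboulis2007Confinement, §4 (text before eq. (4.3))] -/
theorem torusZtw_vortexSheet_eq_zero_plane [NeZero d] {i j : Fin d} (hi : (0 : Fin d) < i)
    (hij : i < j) (J : ℕ) (c : ℕ → ℝ) :
    torusZtw d L J c (vortexSheet L i j hij) = torusZtw d L J c (vortexSheet L 0 j (hi.trans hij)) := by
  rw [← image_plaqTranspose_vortexSheet hi hij, torusZtw_image_plaqTranspose]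

/-- … hence the same for the vortex free-energy ratio `Z⁻/Z`.
[cite: Tomboulis2007Confinement, §4 (text before eq. (4.3)); §6 eq. (6.1)] -/
theorem vortexRatio_vortexSheet_eq_zero_plane [NeZero d] {i j : Fin d} (hi : (0 : Fin d) < i)
    (hij : i < j) (J : ℕ) (c : ℕ → ℝ) :
    vortexRatio d L J c (vortexSheet L i j hij) =
      vortexRatio d L J c (vortexSheet L 0 j (hi.trans hij)) := by
  unfold vortexRatio
  rw [torusZtw_vortexSheet_eq_zero_plane hi hij]

/-- … and for Prop. IV.1 as a statement about the sheet: `TwistLe d L J 𝒱_{ij} ↔ TwistLe d L J 𝒱_{0j}`.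
[cite: Tomboulis2007Confinement, Prop. IV.1 eq. (4.6)] -/
theorem twistLe_vortexSheet_iff_zero_plane [NeZero d] {i j : Fin d} (hi : (0 : Fin d) < i)
    (hij : i < j) (J : ℕ) :
    TwistLe d L J (vortexSheet L i j hij) ↔ TwistLe d L J (vortexSheet L 0 j (hi.trans hij)) := by
  unfold TwistLe
  simp only [torusZtw_vortexSheet_eq_zero_plane hi hij]

omit [NeZero L] in
/-- The transposition `j ↔ k` (`0 < j, k`) carries the direction pair `(0, j)` to `(0, k)` (plumbing).
[folklore] -/
private theorem dirTranspose_zero_right [NeZero d] {j k : Fin d} (hj : (0 : Fin d) < j)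
    (hk : (0 : Fin d) < k) : dirTranspose j k ⟨((0 : Fin d), j), hj⟩ = ⟨(0, k), hk⟩ := by
  have h1 : Equiv.swap j k (0 : Fin d) = 0 := Equiv.swap_apply_of_ne_of_ne hj.ne hk.ne
  have h2 : Equiv.swap j k j = k := Equiv.swap_apply_left _ _
  unfold dirTranspose
  simp only [h1, h2]
  rw [dif_pos hk]

omit [NeZero L] in
/-- … and `(0, k)` back to `(0, j)` (plumbing). [folklore] -/
private theorem dirTranspose_zero_right' [NeZero d] {j k : Fin d} (hj : (0 : Fin d) < j)
    (hk : (0 : Fin d) < k) : dirTranspose j k ⟨((0 : Fin d), k), hk⟩ = ⟨(0, j), hj⟩ := by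
  have h1 : Equiv.swap j k (0 : Fin d) = 0 := Equiv.swap_apply_of_ne_of_ne hj.ne hk.ne
  have h2 : Equiv.swap j k k = j := Equiv.swap_apply_right _ _
  unfold dirTranspose
  simp only [h1, h2]
  rw [dif_pos hj]

/-- The vortex sheets in the planes `(0, j)` and `(0, k)` are transposed images of each other
(plumbing). [folklore] -/
private theorem image_plaqTranspose_vortexSheet_zero [NeZero d] {j k : Fin d} (hj : (0 : Fin d) < j)
    (hk : (0 : Fin d) < k) :
    (vortexSheet L 0 k hk).image (plaqTranspose j k) = vortexSheet L 0 j hj := by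
  ext p
  rw [mem_image_plaqTranspose]
  obtain ⟨x, q⟩ := p
  unfold vortexSheet
  simp only [Finset.mem_filter, Finset.mem_univ, true_and, plaqTranspose, siteTranspose_apply_right,
    siteTranspose_apply_of_ne' hj.ne hk.ne]
  have hq : dirTranspose j k q = ⟨((0 : Fin d), k), hk⟩ ↔ q = ⟨(0, j), hj⟩ := by
    constructor
    · intro h
      rw [← dirTranspose_dirTranspose j k q, h, dirTranspose_zero_right' hj hk]
    · intro h
      rw [h]
      exact dirTranspose_zero_right hj hk
  rw [hq]

/-- **Every vortex sheet is worth the one in the `(0, 1)`-plane**: `Z⁻_Λ(𝒱_{ij}) = Z⁻_Λ(𝒱_{01})` for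
every plane `(i, j)` (every `J`, all coefficients, every torus `(ℤ/Lℤ)^d`, `d ≥ 2`).
[cite: Tomboulis2007Confinement, §4 (text before eq. (4.3))] -/
theorem torusZtw_vortexSheet_eq_plane_zero_one [NeZero d] (h01 : (0 : Fin d) < 1) {i j : Fin d}
    (hij : i < j) (J : ℕ) (c : ℕ → ℝ) :
    torusZtw d L J c (vortexSheet L i j hij) = torusZtw d L J c (vortexSheet L 0 1 h01) := by
  have key : ∀ (k : Fin d) (hk : (0 : Fin d) < k),
      torusZtw d L J c (vortexSheet L 0 k hk) = torusZtw d L J c (vortexSheet L 0 1 h01) := by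
    intro k hk
    rw [← image_plaqTranspose_vortexSheet_zero hk h01, torusZtw_image_plaqTranspose]
  by_cases hi : i = 0
  · subst hi
    exact key j hij
  · have hi' : (0 : Fin d) < i := by
      rw [Fin.lt_def, Fin.val_zero]
      exact Nat.pos_of_ne_zero fun h => hi (Fin.ext (by rw [h, Fin.val_zero]))
    rw [torusZtw_vortexSheet_eq_zero_plane hi' hij]
    exact key j (hi'.trans hij)

/-- … the same for `Z⁻/Z`. [cite: Tomboulis2007Confinement, §4 (text before eq. (4.3)); §6 eq. (6.1)] -/
theorem vortexRatio_vortexSheet_eq_plane_zero_one [NeZero d] (h01 : (0 : Fin d) < 1) {i j : Fin d}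
    (hij : i < j) (J : ℕ) (c : ℕ → ℝ) :
    vortexRatio d L J c (vortexSheet L i j hij) = vortexRatio d L J c (vortexSheet L 0 1 h01) := by
  unfold vortexRatio
  rw [torusZtw_vortexSheet_eq_plane_zero_one h01 hij]

/-- … and for Prop. IV.1: `TwistLe d L J 𝒱_{ij} ↔ TwistLe d L J 𝒱_{01}`.
[cite: Tomboulis2007Confinement, Prop. IV.1 eq. (4.6)] -/
theorem twistLe_vortexSheet_iff_plane_zero_one [NeZero d] (h01 : (0 : Fin d) < 1) {i j : Fin d}
    (hij : i < j) (J : ℕ) :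
    TwistLe d L J (vortexSheet L i j hij) ↔ TwistLe d L J (vortexSheet L 0 1 h01) := by
  unfold TwistLe
  simp only [torusZtw_vortexSheet_eq_plane_zero_one h01 hij]


end Tomboulis2007

end Literature.MathematicalPhysics.QuantumFieldTheory

end
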